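import Literature.AlgebraicGeometry.Motives.HodgeStructureExteriorAlgebraWeylOperator
import Literature.Algebra.Lie.LefschetzModuleWeylOperatorTensor
import Literature.Algebra.Lie.LefschetzModuleTransport
import Literature.LinearAlgebra.Alternating.ExteriorAlgebraDirectSum
import HarnessLib

/-!
# André 1996, §1.3 on `⋀(W₁ ⊕ W₂)`: the Künneth map `⋀W₁ ⊗ ⋀W₂ → ⋀(W₁ ⊕ W₂)` is a morphism of Lefschetz (`𝔰𝔩₂`-)modules
# for `ω₁ ⊞ ω₂ = ⋀(ι₁) ω₁ + ⋀(ι₂) ω₂`; Clebsch–Gordan `Pᵃ(ω₁) ∧ Pᵇ(ω₂) ⊆ P^{a+b}(ω₁ ⊞ ω₂)` (Lemme 1.3.1), `ᶜΛ` is a derivation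
# across the two factors, `w(x ∧ y) = w x ∧ w y`, and LEMME 1.3.2 `*_H (x ∧ y) = (−1)^{ij} *_H x ∧ *_H y`

[topic AlgebraicGeometry/Motives]

Layer `Literature/AlgebraicGeometry/Motives`, lane `lit-hodgefound` (Track 2 foundations library; prover seat `lit-hodgefound-p34`,
generation 31, row g31-#9). THEOREMS ONLY (no `def`, no named fact, no instance, no notation; net debt `0`).

THE SETTING (the linear algebra of `H¹(A × B) = H¹(A) ⊕ H¹(B)`, `H^•(A × B) = ⋀(H¹A ⊕ H¹B) ≅ ⋀H¹A ⊗ ⋀H¹B` for abelian varieties,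
with the polarization `E_A ⊞ E_B` of the product). `W₁`, `W₂` are vector spaces over a field `K` of characteristic `0` carrying
symplectic 2-vectors `ω₁ ∈ ⋀²W₁` of genus `g₁` and `ω₂ ∈ ⋀²W₂` of genus `g₂`; on `W₁ × W₂` we put
`ω₁ ⊞ ω₂ := ⋀(inl) ω₁ + ⋀(inr) ω₂` ("`𝓛_{X×Y} = p₁*𝓛_X ⊗ p₂*𝓛_Y`", so that `L_{X×Y} = L_X ⊗ 1 + 1 ⊗ L_Y`). The KÜNNETH MAP is
Bourbaki's algebra homomorphism `g : ⋀W₁ ᵍ⊗ ⋀W₂ → ⋀(W₁ × W₂)`, `x ⊗ y ↦ ⋀(inl) x ∧ ⋀(inr) y` (tree: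
`LinearAlgebra/Alternating/ExteriorAlgebraDirectSum`, `ExteriorDirectSum.toProd`, an isomorphism `prodEquiv`), regarded as a `K`-linear map
`Φ = toProd ∘ of : ⋀W₁ ⊗ ⋀W₂ → ⋀(W₁ × W₂)` out of the ORDINARY tensor product, which carries the tensor-product Lefschetz module
`(h₁ ⊗ 1 + 1 ⊗ h₂, e_{ω₁} ⊗ 1 + 1 ⊗ e_{ω₂})` of `LefschetzModule` §8 / rows g31-#2 (`LefschetzModuleWeylOperatorTensor`).

## Sources, VERBATIM

Y. André, *Pour une théorie inconditionnelle des motifs*, Publ. Math. IHÉS **83** (1996) [Andre1996Motifs], §1.3 (p. 12): "Nous donnons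
maintenant quelques sorites concernant les involutions `*_L` et `*_H` sur un produit `X × Y` […]. L'isomorphisme (d'algèbres graduées) de
Künneth : `H•(X × Y) ≅ H•(X) ⊗ H•(Y)` devient un isomorphisme de `𝔰𝔩₂`-modules si l'on munit `X × Y` du faisceau inversible ample
`𝓛_{X×Y} = p₁*𝓛_X ⊗ p₂*𝓛_Y`. Par le formalisme des `𝔰𝔩₂`-triplets […] on déduit de l'isomorphisme de `𝔰𝔩₂`-représentations
(Clebsch–Gordan) un isomorphisme canonique `P^n(X × Y) ≅ ⊕ […]`; l'inclusion `P^i(X) ⊗ P^j(Y) ⊆ P^{i+j}(X × Y)` fournie par cet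
isomorphisme est restriction de l'isomorphisme de Künneth." — p. 13: "LEMME 1.3.1. — Considérons `P^i(X) ⊗ P^j(Y)` comme un sous-espace
de `P^{i+j}(X × Y)` […]. LEMME 1.3.2. — Il existe des nombres rationnels `r` tels que […] `*_L x ⊗ *_L y = Σ r […]`. Pour l'involution
de Hodge, on a la formule `*_H x ⊗ *_H y = (−1)^{ij} *_H (x ⊗ y)` […]. La formule pour l'involution de Hodge découle de son interprétation
en termes de l'élément `(0 1 ; −1 0)`" (of `SL₂`, §1.2 p. 11: "s'envoie sur `± *_H`").
N. Bourbaki, *Algebra I*, Ch. III §7 no. 7, Prop. 10 [BourbakiAlgebraI1989] (`⋀(M ⊕ N) ≅ ⋀(M) ᵍ⊗ ⋀(N)`, `g(a ⊗ b) = ⋀(j₁)(a) ∧ ⋀(j₂)(b)`).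
E. Looijenga, V. Lunts, *A Lie algebra attached to a projective variety*, Invent. Math. **129** (1997) [LooijengaLunts1997], §1 (1.1)
p. 4 ("The collection of Lefschetz modules is closed under direct sums, tensor products").

## What is PROVED (`ω₁ ⊞ ω₂ = map inl ω₁ + map inr ω₂`, `G = g₁ + g₂`, `Φ = toProd ∘ of`, `x ∧ y := ⋀(inl) x · ⋀(inr) y`)

* §1 **`twoVector_prod_reindex`, `IsSymplectic.inl_add_inr`: `ω₁ ⊞ ω₂` is symplectic of genus `g₁ + g₂`** (the Darboux bases
  concatenate).
* §2 **THE KÜNNETH MAP IS A MORPHISM OF LEFSCHETZ MODULES** ("devient un isomorphisme de `𝔰𝔩₂`-modules"): `toProd_of_tmul`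
  (`Φ(x ⊗ y) = x ∧ y`), `commute_of_mem_exteriorPower_two_mul` (even elements of an exterior algebra are central),
  `map_inl_mul_map_inr_mem_exteriorPower`, **`toProd_of_rTensor_add_lTensor_mul`** (`Φ ∘ (e_{ω₁} ⊗ 1 + 1 ⊗ e_{ω₂}) = e_{ω₁⊞ω₂} ∘ Φ`),
  **`toProd_of_rTensor_add_lTensor_shiftedDegree`** (`Φ ∘ (h₁ ⊗ 1 + 1 ⊗ h₂) = h ∘ Φ`), `rTensor_add_lTensor_shiftedDegree_ne_zero`.
* §3 **LEMME 1.3.1 (Clebsch–Gordan inclusion) — `map_inl_mul_map_inr_mem_primitive`: `P^{k₁}(ω₁) ∧ P^{k₂}(ω₂) ⊆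
  P^{k₁+k₂}(ω₁ ⊞ ω₂)`**; **`IsSymplectic.lefschetzDual_inl_add_inr_apply`: `ᶜΛ (x ∧ y) = ᶜΛ x ∧ y + x ∧ ᶜΛ y`**
  (`ᶜΛ_{X×Y} = ᶜΛ_X ⊗ 1 + 1 ⊗ ᶜΛ_Y`); **`IsSymplectic.weylStar_inl_add_inr_apply`: `w (x ∧ y) = w x ∧ w y`** (the Weyl element
  `(0 1 ; −1 0)` acts diagonally on a tensor product of `SL₂`-modules); **LEMME 1.3.2 — `IsSymplectic.andreStar_inl_add_inr_apply_of_mem`: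
  `*_H (x ∧ y) = (−1)^{k₁ k₂} *_H x ∧ *_H y`** for `x ∈ ⋀^{k₁} W₁`, `y ∈ ⋀^{k₂} W₂` — each by transporting the abstract tensor statement
  of rows g31-#2 / `LefschetzModule` §8 along `Φ` with row g31-#8 (`LefschetzModuleTransport`).
* §4 **LEMME 1.3.1, LEFSCHETZ CLAUSE — `inl_add_inr_pow_mul_of_mem_primitive`** (the top of the product string:
  `(ω₁ ⊞ ω₂)^{a+b} ∧ (p ∧ q) = C(a+b, a) (ω₁ᵃ ∧ p) ∧ (ω₂ᵇ ∧ q)`, `a = g₁ − k₁`, `b = g₂ − k₂`),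
  `IsSymplectic.lefschetzStar_inl_add_inr_apply_of_mem_primitive` (`*_L (p ∧ q) = C(a+b, a) *_L p ∧ *_L q`),
  **`IsSymplectic.lefschetzStar_inl_add_inr_apply_top`** (`*_L ((ω₁ᵃ ∧ p) ∧ (ω₂ᵇ ∧ q)) = C(a+b, a)⁻¹ · p ∧ q`).

## References

* [Andre1996Motifs] Y. André, *Pour une théorie inconditionnelle des motifs*, Publ. Math. IHÉS 83 (1996), §1.2 (p. 11), §1.3, Lemme 1.3.1,
  Lemme 1.3.2 (pp. 12–13).
* [BourbakiAlgebraI1989] N. Bourbaki, *Algebra I, Chapters 1–3* (1989), Ch. III §7 no. 7 Prop. 10, §7 no. 3 Cor. 2 to Prop. 5.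
* [LooijengaLunts1997] E. Looijenga, V. Lunts, *A Lie algebra attached to a projective variety*, Invent. Math. 129 (1997), §1 (1.1) p. 4.
-/

noncomputable section

open scoped TensorProduct

namespace Literature.AlgebraicGeometry.Motives

namespace ExteriorLefschetz

open Literature.Algebra.Lie ExteriorAlgebra
open Literature.Algebra.Lie.HasLefschetzProperty (primitiveSpace mem_primitiveSpace_iff)
open Literature.LinearAlgebra.Alternating (mul_comm_of_mem_exteriorPower map_coe_mem_exteriorPower extGrading ι_mem_exteriorPower_one)

variable {K : Type*} [Field K] {W₁ W₂ : Type*} [AddCommGroup W₁] [Module K W₁] [AddCommGroup W₂] [Module K W₂]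

/-! ## §1 `ω₁ ⊞ ω₂` is symplectic of genus `g₁ + g₂` -/

/-- The 2-vector of the concatenated Darboux basis of `W₁ × W₂` is `⋀(inl) ω₁ + ⋀(inr) ω₂`.
[cite: Andre1996Motifs, §1.3 (p. 12, "𝓛_{X×Y} = p₁*𝓛_X ⊗ p₂*𝓛_Y")] [cite: McDuffSalamon2017, Thm. 2.1.3] -/
theorem twoVector_prod_reindex {g₁ g₂ : ℕ} (b₁ : Module.Basis (Fin g₁ ⊕ Fin g₁) K W₁) (b₂ : Module.Basis (Fin g₂ ⊕ Fin g₂) K W₂) :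
    twoVector ((b₁.prod b₂).reindex ((Equiv.sumSumSumComm (Fin g₁) (Fin g₁) (Fin g₂) (Fin g₂)).trans
        (Equiv.sumCongr finSumFinEquiv finSumFinEquiv))) =
      ExteriorAlgebra.map (LinearMap.inl K W₁ W₂) (twoVector b₁) + ExteriorAlgebra.map (LinearMap.inr K W₁ W₂) (twoVector b₂) := by
  simp only [twoVector, map_sum, map_mul, map_apply_ι]
  rw [Fin.sum_univ_add]
  congr 1
  · refine Finset.sum_congr rfl fun a _ ↦ ?_
    have h1 : ((Equiv.sumSumSumComm (Fin g₁) (Fin g₁) (Fin g₂) (Fin g₂)).trans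
        (Equiv.sumCongr finSumFinEquiv finSumFinEquiv)).symm (Sum.inl (Fin.castAdd g₂ a)) = Sum.inl (Sum.inl a) := by
      simp [Equiv.sumSumSumComm]
    have h2 : ((Equiv.sumSumSumComm (Fin g₁) (Fin g₁) (Fin g₂) (Fin g₂)).trans
        (Equiv.sumCongr finSumFinEquiv finSumFinEquiv)).symm (Sum.inr (Fin.castAdd g₂ a)) = Sum.inl (Sum.inr a) := by
      simp [Equiv.sumSumSumComm]
    rw [Module.Basis.reindex_apply, Module.Basis.reindex_apply, h1, h2, Module.Basis.prod_apply, Module.Basis.prod_apply,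
      Sum.elim_inl, Sum.elim_inl, Function.comp_apply, Function.comp_apply]
  · refine Finset.sum_congr rfl fun c _ ↦ ?_
    have h1 : ((Equiv.sumSumSumComm (Fin g₁) (Fin g₁) (Fin g₂) (Fin g₂)).trans
        (Equiv.sumCongr finSumFinEquiv finSumFinEquiv)).symm (Sum.inl (Fin.natAdd g₁ c)) = Sum.inr (Sum.inl c) := by
      simp [Equiv.sumSumSumComm]
    have h2 : ((Equiv.sumSumSumComm (Fin g₁) (Fin g₁) (Fin g₂) (Fin g₂)).trans
        (Equiv.sumCongr finSumFinEquiv finSumFinEquiv)).symm (Sum.inr (Fin.natAdd g₁ c)) = Sum.inr (Sum.inr c) := by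
      simp [Equiv.sumSumSumComm]
    rw [Module.Basis.reindex_apply, Module.Basis.reindex_apply, h1, h2, Module.Basis.prod_apply, Module.Basis.prod_apply,
      Sum.elim_inr, Sum.elim_inr, Function.comp_apply, Function.comp_apply]

/-- **`ω₁ ⊞ ω₂ = ⋀(inl) ω₁ + ⋀(inr) ω₂` is symplectic of genus `g₁ + g₂`** when `ωᵢ` is symplectic of genus `gᵢ` (concatenate the
Darboux bases). [cite: Andre1996Motifs, §1.3 (p. 12)] [cite: McDuffSalamon2017, Thm. 2.1.3] -/
theorem IsSymplectic.inl_add_inr {ω₁ : ExteriorAlgebra K W₁} {ω₂ : ExteriorAlgebra K W₂} {g₁ g₂ : ℕ} (h₁ : IsSymplectic ω₁ g₁)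
    (h₂ : IsSymplectic ω₂ g₂) :
    IsSymplectic (ExteriorAlgebra.map (LinearMap.inl K W₁ W₂) ω₁ + ExteriorAlgebra.map (LinearMap.inr K W₁ W₂) ω₂) (g₁ + g₂) := by
  obtain ⟨b₁, rfl⟩ := h₁
  obtain ⟨b₂, rfl⟩ := h₂
  exact ⟨_, (twoVector_prod_reindex b₁ b₂).symm⟩

/-! ## §2 The Künneth map `Φ = toProd ∘ of : ⋀W₁ ⊗ ⋀W₂ → ⋀(W₁ × W₂)` is a morphism of Lefschetz modules -/

/-- `Φ (x ⊗ y) = ⋀(inl) x ∧ ⋀(inr) y`. [cite: BourbakiAlgebraI1989, Ch. III §7 no. 7, Prop. 10 (formula (14))] -/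
theorem toProd_of_tmul (x : ExteriorAlgebra K W₁) (y : ExteriorAlgebra K W₂) :
    ((Literature.LinearAlgebra.Alternating.ExteriorDirectSum.toProd K W₁ W₂).toLinearMap ∘ₗ (GradedTensorProduct.of K (extGrading K W₁) (extGrading K W₂)).toLinearMap) (x ⊗ₜ[K] y) =
      ExteriorAlgebra.map (LinearMap.inl K W₁ W₂) x * ExteriorAlgebra.map (LinearMap.inr K W₁ W₂) y := by
  rw [LinearMap.comp_apply, AlgHom.toLinearMap_apply, LinearEquiv.coe_toLinearMap]
  exact Literature.LinearAlgebra.Alternating.ExteriorDirectSum.toProd_tmul K W₁ W₂ x y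

/-- **Even elements of an exterior algebra are central**: `c ∈ ⋀^{2n} V` commutes with every `z ∈ ⋀V` (`c ∧ v = (−1)^{2n} v ∧ c` on
generators). [cite: BourbakiAlgebraI1989, Ch. III §7 no. 3, Cor. 2 to Prop. 5] -/
theorem commute_of_mem_exteriorPower_two_mul {V : Type*} [AddCommGroup V] [Module K V] {n : ℕ} {c : ExteriorAlgebra K V}
    (hc : c ∈ ⋀[K]^(2 * n) V) (z : ExteriorAlgebra K V) : Commute c z := by
  induction z using ExteriorAlgebra.induction with
  | algebraMap r => exact Algebra.commute_algebraMap_right r c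
  | ι v =>
    have h1 := mul_comm_of_mem_exteriorPower K hc (ι_mem_exteriorPower_one K v)
    rw [show 1 * (2 * n) = n + n by ring, uzpow_add, ← mul_uzpow, Int.units_mul_self, one_uzpow, one_smul] at h1
    exact h1
  | mul a b ha hb => exact ha.mul_right hb
  | add a b ha hb => exact ha.add_right hb

/-- `⋀(inl) x ∧ ⋀(inr) y ∈ ⋀^{i+j}(W₁ × W₂)` for `x ∈ ⋀ⁱ W₁`, `y ∈ ⋀ʲ W₂`. [cite: BourbakiAlgebraI1989, Ch. III §7 no. 7, Prop. 10 and Cor.] -/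
theorem map_inl_mul_map_inr_mem_exteriorPower {i j : ℕ} {x : ExteriorAlgebra K W₁} {y : ExteriorAlgebra K W₂} (hx : x ∈ ⋀[K]^i W₁)
    (hy : y ∈ ⋀[K]^j W₂) :
    ExteriorAlgebra.map (LinearMap.inl K W₁ W₂) x * ExteriorAlgebra.map (LinearMap.inr K W₁ W₂) y ∈ ⋀[K]^(i + j) (W₁ × W₂) :=
  SetLike.mul_mem_graded (map_coe_mem_exteriorPower K _ ⟨x, hx⟩) (map_coe_mem_exteriorPower K _ ⟨y, hy⟩)

/-- **`Φ ∘ (e_{ω₁} ⊗ 1 + 1 ⊗ e_{ω₂}) = e_{ω₁ ⊞ ω₂} ∘ Φ`** ("`L_{X×Y} = L_X ⊗ 1 + 1 ⊗ L_Y`": `(ω₁ ⊞ ω₂) ∧ (x ∧ y) = (ω₁ ∧ x) ∧ y + x ∧ (ω₂ ∧ y)`,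
`⋀(inr) ω₂` being even hence central). [cite: Andre1996Motifs, §1.3 (p. 12, "𝓛_{X×Y} = p₁*𝓛_X ⊗ p₂*𝓛_Y")] -/
theorem toProd_of_rTensor_add_lTensor_mul (ω₁ : ExteriorAlgebra K W₁) {ω₂ : ExteriorAlgebra K W₂} (hω₂ : ω₂ ∈ ⋀[K]^2 W₂)
    (z : ExteriorAlgebra K W₁ ⊗[K] ExteriorAlgebra K W₂) :
    ((Literature.LinearAlgebra.Alternating.ExteriorDirectSum.toProd K W₁ W₂).toLinearMap ∘ₗ (GradedTensorProduct.of K (extGrading K W₁) (extGrading K W₂)).toLinearMap)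
        (((LinearMap.mul K (ExteriorAlgebra K W₁) ω₁).rTensor (ExteriorAlgebra K W₂) +
          (LinearMap.mul K (ExteriorAlgebra K W₂) ω₂).lTensor (ExteriorAlgebra K W₁)) z) =
      LinearMap.mul K (ExteriorAlgebra K (W₁ × W₂))
          (ExteriorAlgebra.map (LinearMap.inl K W₁ W₂) ω₁ + ExteriorAlgebra.map (LinearMap.inr K W₁ W₂) ω₂)
        (((Literature.LinearAlgebra.Alternating.ExteriorDirectSum.toProd K W₁ W₂).toLinearMap ∘ₗ (GradedTensorProduct.of K (extGrading K W₁) (extGrading K W₂)).toLinearMap) z) := by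
  induction z using TensorProduct.induction_on with
  | zero => simp only [map_zero]
  | add a b ha hb => simp only [map_add, ha, hb]
  | tmul x y =>
    have hc : Commute (ExteriorAlgebra.map (LinearMap.inr K W₁ W₂) ω₂) (ExteriorAlgebra.map (LinearMap.inl K W₁ W₂) x) :=
      commute_of_mem_exteriorPower_two_mul (n := 1) (map_coe_mem_exteriorPower K _ ⟨ω₂, hω₂⟩) _
    rw [LinearMap.add_apply, LinearMap.rTensor_tmul, LinearMap.lTensor_tmul, map_add, toProd_of_tmul, toProd_of_tmul, toProd_of_tmul,
      LinearMap.mul_apply', LinearMap.mul_apply', LinearMap.mul_apply', map_mul, map_mul, add_mul, mul_assoc]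
    congr 1
    rw [← mul_assoc, ← mul_assoc, hc.eq]

/-- **`Φ ∘ (h₁ ⊗ 1 + 1 ⊗ h₂) = h ∘ Φ`** for the shifted degree operators (`(i − g₁) + (j − g₂) = (i + j) − (g₁ + g₂)` on `⋀ⁱ ⊗ ⋀ʲ`):
with the previous statement, "l'isomorphisme de Künneth devient un isomorphisme de `𝔰𝔩₂`-modules". [cite: Andre1996Motifs, §1.3 (p. 12)]
[cite: LooijengaLunts1997, §1 (1.1) p. 4] -/
theorem toProd_of_rTensor_add_lTensor_shiftedDegree (g₁ g₂ : ℕ) (z : ExteriorAlgebra K W₁ ⊗[K] ExteriorAlgebra K W₂) :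
    ((Literature.LinearAlgebra.Alternating.ExteriorDirectSum.toProd K W₁ W₂).toLinearMap ∘ₗ (GradedTensorProduct.of K (extGrading K W₁) (extGrading K W₂)).toLinearMap)
        (((shiftedDegree K (fun i : ℕ ↦ ⋀[K]^i W₁) g₁).rTensor (ExteriorAlgebra K W₂) +
          (shiftedDegree K (fun i : ℕ ↦ ⋀[K]^i W₂) g₂).lTensor (ExteriorAlgebra K W₁)) z) =
      shiftedDegree K (fun i : ℕ ↦ ⋀[K]^i (W₁ × W₂)) (g₁ + g₂)
        (((Literature.LinearAlgebra.Alternating.ExteriorDirectSum.toProd K W₁ W₂).toLinearMap ∘ₗ (GradedTensorProduct.of K (extGrading K W₁) (extGrading K W₂)).toLinearMap) z) := by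
  induction z using TensorProduct.induction_on with
  | zero => simp only [map_zero]
  | add a b ha hb => simp only [map_add, ha, hb]
  | tmul x y =>
    have hx : x ∈ ⨆ i : ℕ, ⋀[K]^i W₁ := by
      rw [(DirectSum.Decomposition.isInternal (fun i : ℕ ↦ ⋀[K]^i W₁)).submodule_iSup_eq_top]; exact Submodule.mem_top
    have hy : y ∈ ⨆ j : ℕ, ⋀[K]^j W₂ := by
      rw [(DirectSum.Decomposition.isInternal (fun i : ℕ ↦ ⋀[K]^i W₂)).submodule_iSup_eq_top]; exact Submodule.mem_top
    refine Submodule.iSup_induction (fun i : ℕ ↦ ⋀[K]^i W₁)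
      (motive := fun x ↦ ((Literature.LinearAlgebra.Alternating.ExteriorDirectSum.toProd K W₁ W₂).toLinearMap ∘ₗ (GradedTensorProduct.of K (extGrading K W₁) (extGrading K W₂)).toLinearMap)
          (((shiftedDegree K (fun i : ℕ ↦ ⋀[K]^i W₁) g₁).rTensor (ExteriorAlgebra K W₂) +
            (shiftedDegree K (fun i : ℕ ↦ ⋀[K]^i W₂) g₂).lTensor (ExteriorAlgebra K W₁)) (x ⊗ₜ[K] y)) =
        shiftedDegree K (fun i : ℕ ↦ ⋀[K]^i (W₁ × W₂)) (g₁ + g₂) (((Literature.LinearAlgebra.Alternating.ExteriorDirectSum.toProd K W₁ W₂).toLinearMap ∘ₗ (GradedTensorProduct.of K (extGrading K W₁) (extGrading K W₂)).toLinearMap) (x ⊗ₜ[K] y)))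
      hx (fun i x hx ↦ ?_) (by simp only [TensorProduct.zero_tmul, map_zero])
      (fun x x' h h' ↦ by simp only [TensorProduct.add_tmul, map_add, h, h'])
    refine Submodule.iSup_induction (fun j : ℕ ↦ ⋀[K]^j W₂)
      (motive := fun y ↦ ((Literature.LinearAlgebra.Alternating.ExteriorDirectSum.toProd K W₁ W₂).toLinearMap ∘ₗ (GradedTensorProduct.of K (extGrading K W₁) (extGrading K W₂)).toLinearMap)
          (((shiftedDegree K (fun i : ℕ ↦ ⋀[K]^i W₁) g₁).rTensor (ExteriorAlgebra K W₂) +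
            (shiftedDegree K (fun i : ℕ ↦ ⋀[K]^i W₂) g₂).lTensor (ExteriorAlgebra K W₁)) (x ⊗ₜ[K] y)) =
        shiftedDegree K (fun i : ℕ ↦ ⋀[K]^i (W₁ × W₂)) (g₁ + g₂) (((Literature.LinearAlgebra.Alternating.ExteriorDirectSum.toProd K W₁ W₂).toLinearMap ∘ₗ (GradedTensorProduct.of K (extGrading K W₁) (extGrading K W₂)).toLinearMap) (x ⊗ₜ[K] y)))
      hy (fun j y hy ↦ ?_) (by simp only [TensorProduct.tmul_zero, map_zero])
      (fun y y' h h' ↦ by simp only [TensorProduct.tmul_add, map_add, h, h'])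
    rw [LinearMap.add_apply, LinearMap.rTensor_tmul, LinearMap.lTensor_tmul, map_add,
      shiftedDegree_apply_of_mem_exteriorPower g₁ hx, shiftedDegree_apply_of_mem_exteriorPower g₂ hy, ← TensorProduct.smul_tmul',
      TensorProduct.tmul_smul, map_smul, map_smul, toProd_of_tmul, ← add_smul,
      shiftedDegree_apply_of_mem_exteriorPower (g₁ + g₂) (map_inl_mul_map_inr_mem_exteriorPower hx hy)]
    congr 1
    push_cast
    ring

/-- `h₁ ⊗ 1 + 1 ⊗ h₂ ≠ 0` as soon as `g₁ + g₂ > 0` (it is `−(g₁ + g₂)` on `1 ⊗ 1`) — the non-degeneracy hypothesis of the tensor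
sorites of `LefschetzModule` §8. [cite: LooijengaLunts1997, §1 (1.1) p. 4] -/
theorem rTensor_add_lTensor_shiftedDegree_ne_zero [CharZero K] {g₁ g₂ : ℕ} (h12 : 0 < g₁ + g₂) :
    (shiftedDegree K (fun i : ℕ ↦ ⋀[K]^i W₁) g₁).rTensor (ExteriorAlgebra K W₂) +
        (shiftedDegree K (fun i : ℕ ↦ ⋀[K]^i W₂) g₂).lTensor (ExteriorAlgebra K W₁) ≠ 0 := by
  intro h0
  have h1 := LinearMap.congr_fun h0 ((1 : ExteriorAlgebra K W₁) ⊗ₜ[K] (1 : ExteriorAlgebra K W₂))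
  rw [LinearMap.add_apply, LinearMap.rTensor_tmul, LinearMap.lTensor_tmul, LinearMap.zero_apply,
    shiftedDegree_apply_of_mem_exteriorPower g₁ (SetLike.one_mem_graded _),
    shiftedDegree_apply_of_mem_exteriorPower g₂ (SetLike.one_mem_graded _), ← TensorProduct.smul_tmul', TensorProduct.tmul_smul,
    ← add_smul, ← Algebra.TensorProduct.one_def, smul_eq_zero] at h1
  rcases h1 with h1 | h1
  · have h2 : ((g₁ + g₂ : ℕ) : K) = 0 := by
      push_cast at h1 ⊢
      linear_combination -h1
    rw [Nat.cast_eq_zero] at h2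
    omega
  · exact one_ne_zero h1

/-! ## §3 Lemme 1.3.1, `ᶜΛ`, `w` and Lemme 1.3.2 on `x ∧ y` -/

section Symplectic

variable [CharZero K] {ω₁ : ExteriorAlgebra K W₁} {ω₂ : ExteriorAlgebra K W₂} {g₁ g₂ : ℕ}

/-- **LEMME 1.3.1 (Clebsch–Gordan inclusion): `P^{k₁}(ω₁) ∧ P^{k₂}(ω₂) ⊆ P^{k₁+k₂}(ω₁ ⊞ ω₂)`** — "l'inclusion `P^i(X) ⊗ P^j(Y) ⊆
P^{i+j}(X × Y)` fournie par [Clebsch–Gordan] est restriction de l'isomorphisme de Künneth" (`p ⊗ q` is a lowest-weight vector of weight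
`−(g₁−k₁)−(g₂−k₂)` killed by `E^{(g₁−k₁)+(g₂−k₂)+1}`, and `Φ` is a morphism of Lefschetz modules; only `ω₂ ∈ ⋀²` is used).
[cite: Andre1996Motifs, §1.3 (p. 12) and Lemme 1.3.1 (p. 13)] -/
theorem map_inl_mul_map_inr_mem_primitive (ω₁ : ExteriorAlgebra K W₁) (hω₂ : ω₂ ∈ ⋀[K]^2 W₂) {k₁ k₂ : ℕ} (hk₁ : k₁ ≤ g₁) (hk₂ : k₂ ≤ g₂)
    {p : ExteriorAlgebra K W₁} {q : ExteriorAlgebra K W₂} (hp : p ∈ primitive ω₁ g₁ k₁) (hq : q ∈ primitive ω₂ g₂ k₂) :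
    ExteriorAlgebra.map (LinearMap.inl K W₁ W₂) p * ExteriorAlgebra.map (LinearMap.inr K W₁ W₂) q ∈
      primitive (ExteriorAlgebra.map (LinearMap.inl K W₁ W₂) ω₁ + ExteriorAlgebra.map (LinearMap.inr K W₁ W₂) ω₂) (g₁ + g₂) (k₁ + k₂) := by
  rw [primitive_eq_primitiveSpace _ _ hk₁] at hp
  rw [primitive_eq_primitiveSpace _ _ hk₂] at hq
  rw [primitive_eq_primitiveSpace _ _ (add_le_add hk₁ hk₂), show g₁ + g₂ - (k₁ + k₂) = (g₁ - k₁) + (g₂ - k₂) by omega, ← toProd_of_tmul]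
  exact apply_mem_primitiveSpace_of_semiconj (toProd_of_rTensor_add_lTensor_shiftedDegree g₁ g₂)
    (toProd_of_rTensor_add_lTensor_mul ω₁ hω₂) (tmul_mem_primitiveSpace hp hq)

/-- **`ᶜΛ_{ω₁⊞ω₂} (x ∧ y) = ᶜΛ_{ω₁} x ∧ y + x ∧ ᶜΛ_{ω₂} y`** (`ᶜΛ_{X×Y} = ᶜΛ_X ⊗ 1 + 1 ⊗ ᶜΛ_Y`: the `𝔰𝔩₂`-partner of `e ⊗ 1 + 1 ⊗ e'` is
`f ⊗ 1 + 1 ⊗ f'`, transported along `Φ`; `g₁, g₂ ≥ 1`). [cite: Andre1996Motifs, §1.3 (p. 12)] [cite: LooijengaLunts1997, §1 (1.1) p. 4 and §3 (3.3) p. 13] -/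
theorem IsSymplectic.lefschetzDual_inl_add_inr_apply (hω₁ : IsSymplectic ω₁ g₁) (hω₂ : IsSymplectic ω₂ g₂) (hg₁ : 0 < g₁) (hg₂ : 0 < g₂)
    (x : ExteriorAlgebra K W₁) (y : ExteriorAlgebra K W₂) :
    lefschetzDual (ExteriorAlgebra.map (LinearMap.inl K W₁ W₂) ω₁ + ExteriorAlgebra.map (LinearMap.inr K W₁ W₂) ω₂) (g₁ + g₂)
        (ExteriorAlgebra.map (LinearMap.inl K W₁ W₂) x * ExteriorAlgebra.map (LinearMap.inr K W₁ W₂) y) =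
      ExteriorAlgebra.map (LinearMap.inl K W₁ W₂) (lefschetzDual ω₁ g₁ x) * ExteriorAlgebra.map (LinearMap.inr K W₁ W₂) y +
        ExteriorAlgebra.map (LinearMap.inl K W₁ W₂) x * ExteriorAlgebra.map (LinearMap.inr K W₁ W₂) (lefschetzDual ω₂ g₂ y) := by
  haveI := hω₁.finiteDimensional_exteriorAlgebra
  haveI := hω₂.finiteDimensional_exteriorAlgebra
  have hΩ := hω₁.inl_add_inr hω₂
  haveI := hΩ.finiteDimensional_exteriorAlgebra
  have h0 := rTensor_add_lTensor_shiftedDegree_ne_zero (K := K) (W₁ := W₁) (W₂ := W₂) (add_pos hg₁ hg₂)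
  have key := (hω₁.hasLefschetzProperty_mul.tensor (isZGrading_shiftedDegree K (fun i : ℕ ↦ ⋀[K]^i W₁) g₁)
    hω₂.hasLefschetzProperty_mul (isZGrading_shiftedDegree K (fun i : ℕ ↦ ⋀[K]^i W₂) g₂)).map_dual_of_semiconj
    (isZGrading_rTensor_add_lTensor (isZGrading_shiftedDegree K (fun i : ℕ ↦ ⋀[K]^i W₁) g₁)
      (isZGrading_shiftedDegree K (fun i : ℕ ↦ ⋀[K]^i W₂) g₂))
    hΩ.hasLefschetzProperty_mul (isZGrading_shiftedDegree K (fun i : ℕ ↦ ⋀[K]^i (W₁ × W₂)) (g₁ + g₂))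
    (toProd_of_rTensor_add_lTensor_shiftedDegree g₁ g₂) (toProd_of_rTensor_add_lTensor_mul ω₁ hω₂.mem) (x ⊗ₜ[K] y)
  rw [hω₁.hasLefschetzProperty_mul.dual_tensor (isZGrading_shiftedDegree K _ g₁) hω₂.hasLefschetzProperty_mul
      (isZGrading_shiftedDegree K _ g₂) h0, LinearMap.add_apply, LinearMap.rTensor_tmul,
    LinearMap.lTensor_tmul, map_add, toProd_of_tmul, toProd_of_tmul, toProd_of_tmul, hω₁.dual_eq_lefschetzDual hg₁,
    hω₂.dual_eq_lefschetzDual hg₂, hΩ.dual_eq_lefschetzDual (add_pos hg₁ hg₂)] at key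
  exact key.symm

/-- **`w_{ω₁⊞ω₂} (x ∧ y) = w_{ω₁} x ∧ w_{ω₂} y`**: the Weyl element `w = exp(ᶜΛ) exp(−L) exp(ᶜΛ)` (image of `(0 1 ; −1 0) ∈ SL₂`) acts
diagonally on the tensor product of the two `SL₂`-modules (`w_{M⊗N} = w ⊗ w'`, row g31-#2), transported along `Φ` (`g₁ + g₂ ≥ 1`).
[cite: Andre1996Motifs, §1.2 (p. 11) and §1.3, Lemme 1.3.2 (p. 13, "interprétation en termes de l'élément (0 1 ; −1 0)")] -/
theorem IsSymplectic.weylStar_inl_add_inr_apply (hω₁ : IsSymplectic ω₁ g₁) (hω₂ : IsSymplectic ω₂ g₂) (h12 : 0 < g₁ + g₂)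
    (x : ExteriorAlgebra K W₁) (y : ExteriorAlgebra K W₂) :
    weylStar (ExteriorAlgebra.map (LinearMap.inl K W₁ W₂) ω₁ + ExteriorAlgebra.map (LinearMap.inr K W₁ W₂) ω₂) (g₁ + g₂)
        (ExteriorAlgebra.map (LinearMap.inl K W₁ W₂) x * ExteriorAlgebra.map (LinearMap.inr K W₁ W₂) y) =
      ExteriorAlgebra.map (LinearMap.inl K W₁ W₂) (weylStar ω₁ g₁ x) * ExteriorAlgebra.map (LinearMap.inr K W₁ W₂) (weylStar ω₂ g₂ y) := by
  haveI := hω₁.finiteDimensional_exteriorAlgebra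
  haveI := hω₂.finiteDimensional_exteriorAlgebra
  have hΩ := hω₁.inl_add_inr hω₂
  haveI := hΩ.finiteDimensional_exteriorAlgebra
  have h0 := rTensor_add_lTensor_shiftedDegree_ne_zero (K := K) (W₁ := W₁) (W₂ := W₂) h12
  have key := (hω₁.hasLefschetzProperty_mul.tensor (isZGrading_shiftedDegree K (fun i : ℕ ↦ ⋀[K]^i W₁) g₁)
    hω₂.hasLefschetzProperty_mul (isZGrading_shiftedDegree K (fun i : ℕ ↦ ⋀[K]^i W₂) g₂)).map_weylOperator_of_semiconj
    (isZGrading_rTensor_add_lTensor (isZGrading_shiftedDegree K (fun i : ℕ ↦ ⋀[K]^i W₁) g₁)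
      (isZGrading_shiftedDegree K (fun i : ℕ ↦ ⋀[K]^i W₂) g₂))
    hΩ.hasLefschetzProperty_mul (isZGrading_shiftedDegree K (fun i : ℕ ↦ ⋀[K]^i (W₁ × W₂)) (g₁ + g₂))
    (toProd_of_rTensor_add_lTensor_shiftedDegree g₁ g₂) (toProd_of_rTensor_add_lTensor_mul ω₁ hω₂.mem) (x ⊗ₜ[K] y)
  rw [hω₁.hasLefschetzProperty_mul.weylOperator_tensor_tmul (isZGrading_shiftedDegree K _ g₁) hω₂.hasLefschetzProperty_mul
      (isZGrading_shiftedDegree K _ g₂) h0, toProd_of_tmul, toProd_of_tmul,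
    ← hω₁.weylStar_eq, ← hω₂.weylStar_eq, ← hΩ.weylStar_eq] at key
  exact key.symm

/-- **ANDRÉ'S LEMME 1.3.2 on `⋀(W₁ ⊕ W₂)`: `*_H (x ∧ y) = (−1)^{k₁ k₂} *_H x ∧ *_H y`** for `x ∈ ⋀^{k₁} W₁`, `y ∈ ⋀^{k₂} W₂` ("Pour
l'involution de Hodge, on a la formule `*_H x ⊗ *_H y = (−1)^{ij} *_H (x ⊗ y)`"; `*_H` is ANDRÉ'S involution `andreStar`, with the factor
`k!/(d−j+k)!`; `g₁ + g₂ ≥ 1`). [cite: Andre1996Motifs, §1.3 Lemme 1.3.2 (p. 13)] -/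
theorem IsSymplectic.andreStar_inl_add_inr_apply_of_mem (hω₁ : IsSymplectic ω₁ g₁) (hω₂ : IsSymplectic ω₂ g₂) (h12 : 0 < g₁ + g₂)
    {k₁ k₂ : ℕ} {x : ExteriorAlgebra K W₁} {y : ExteriorAlgebra K W₂} (hx : x ∈ ⋀[K]^k₁ W₁) (hy : y ∈ ⋀[K]^k₂ W₂) :
    andreStar (ExteriorAlgebra.map (LinearMap.inl K W₁ W₂) ω₁ + ExteriorAlgebra.map (LinearMap.inr K W₁ W₂) ω₂) (g₁ + g₂)
        (ExteriorAlgebra.map (LinearMap.inl K W₁ W₂) x * ExteriorAlgebra.map (LinearMap.inr K W₁ W₂) y) =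
      ((-1 : K) ^ (k₁ * k₂)) • (ExteriorAlgebra.map (LinearMap.inl K W₁ W₂) (andreStar ω₁ g₁ x) *
        ExteriorAlgebra.map (LinearMap.inr K W₁ W₂) (andreStar ω₂ g₂ y)) := by
  haveI := hω₁.finiteDimensional_exteriorAlgebra
  haveI := hω₂.finiteDimensional_exteriorAlgebra
  have hΩ := hω₁.inl_add_inr hω₂
  haveI := hΩ.finiteDimensional_exteriorAlgebra
  have h0 := rTensor_add_lTensor_shiftedDegree_ne_zero (K := K) (W₁ := W₁) (W₂ := W₂) h12
  have hx' : x ∈ degreeSpace (shiftedDegree K (fun i : ℕ ↦ ⋀[K]^i W₁) g₁) ((k₁ : ℤ) - g₁) := by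
    rw [degreeSpace_shiftedDegree_eq_exteriorPower g₁ ((k₁ : ℤ) - g₁) k₁ (by omega)]; exact hx
  have hy' : y ∈ degreeSpace (shiftedDegree K (fun i : ℕ ↦ ⋀[K]^i W₂) g₂) ((k₂ : ℤ) - g₂) := by
    rw [degreeSpace_shiftedDegree_eq_exteriorPower g₂ ((k₂ : ℤ) - g₂) k₂ (by omega)]; exact hy
  have key := (hω₁.hasLefschetzProperty_mul.tensor (isZGrading_shiftedDegree K (fun i : ℕ ↦ ⋀[K]^i W₁) g₁)
    hω₂.hasLefschetzProperty_mul (isZGrading_shiftedDegree K (fun i : ℕ ↦ ⋀[K]^i W₂) g₂)).map_andreHodgeInvolution_of_semiconj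
    (isZGrading_rTensor_add_lTensor (isZGrading_shiftedDegree K (fun i : ℕ ↦ ⋀[K]^i W₁) g₁)
      (isZGrading_shiftedDegree K (fun i : ℕ ↦ ⋀[K]^i W₂) g₂))
    hΩ.hasLefschetzProperty_mul (isZGrading_shiftedDegree K (fun i : ℕ ↦ ⋀[K]^i (W₁ × W₂)) (g₁ + g₂))
    (toProd_of_rTensor_add_lTensor_shiftedDegree g₁ g₂) (toProd_of_rTensor_add_lTensor_mul ω₁ hω₂.mem) (g₁ + g₂) (x ⊗ₜ[K] y)
  rw [hω₁.hasLefschetzProperty_mul.andreHodgeInvolution_tensor_tmul (isZGrading_shiftedDegree K _ g₁) hω₂.hasLefschetzProperty_mul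
      (isZGrading_shiftedDegree K _ g₂) h0
      (le_of_eq hω₁.depth_shiftedDegree_eq) (le_of_eq hω₂.depth_shiftedDegree_eq) (n := k₁) (n' := k₂) (by omega)
      (by omega) hx' hy',
    map_smul, toProd_of_tmul, toProd_of_tmul, ← hω₁.andreStar_eq, ← hω₂.andreStar_eq, ← hΩ.andreStar_eq] at key
  exact key.symm

/-! ## §4 Lemme 1.3.1, Lefschetz clause: the top of a product string and `*_L` on it -/

/-- **The top of the product string through `p ∧ q`: `(ω₁ ⊞ ω₂)^{a+b} ∧ (p ∧ q) = C(a+b, a) · (ω₁ᵃ ∧ p) ∧ (ω₂ᵇ ∧ q)`** for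
`p ∈ P^{k₁}(ω₁)`, `q ∈ P^{k₂}(ω₂)`, `a = g₁ − k₁`, `b = g₂ − k₂` (all other terms of the binomial expansion vanish: `ω₁^{a+1} ∧ p = 0`,
`ω₂^{b+1} ∧ q = 0`) — "l'inverse de cet isomorphisme est `L^{d+d'−i−j}_{X×Y}` [qui] coïncide avec `c · L^{d−i}_X ⊗ L^{d'−j}_Y` sur
`Pⁱ(X) ⊗ Pʲ(Y)`". [cite: Andre1996Motifs, §1.3 Lemme 1.3.1 (p. 13, proof)] -/
theorem inl_add_inr_pow_mul_of_mem_primitive (ω₁ : ExteriorAlgebra K W₁) (hω₂ : ω₂ ∈ ⋀[K]^2 W₂) {k₁ k₂ : ℕ} (hk₁ : k₁ ≤ g₁)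
    (hk₂ : k₂ ≤ g₂) {p : ExteriorAlgebra K W₁} {q : ExteriorAlgebra K W₂} (hp : p ∈ primitive ω₁ g₁ k₁) (hq : q ∈ primitive ω₂ g₂ k₂) :
    (ExteriorAlgebra.map (LinearMap.inl K W₁ W₂) ω₁ + ExteriorAlgebra.map (LinearMap.inr K W₁ W₂) ω₂) ^ ((g₁ - k₁) + (g₂ - k₂)) *
        (ExteriorAlgebra.map (LinearMap.inl K W₁ W₂) p * ExteriorAlgebra.map (LinearMap.inr K W₁ W₂) q) =
      ((((g₁ - k₁) + (g₂ - k₂)).choose (g₁ - k₁) : ℕ) : K) •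
        (ExteriorAlgebra.map (LinearMap.inl K W₁ W₂) (ω₁ ^ (g₁ - k₁) * p) * ExteriorAlgebra.map (LinearMap.inr K W₁ W₂) (ω₂ ^ (g₂ - k₂) * q)) := by
  rw [primitive_eq_primitiveSpace _ _ hk₁] at hp
  rw [primitive_eq_primitiveSpace _ _ hk₂] at hq
  have key := pow_rTensor_add_lTensor_apply_tmul_primitive hp hq
  apply_fun ((Literature.LinearAlgebra.Alternating.ExteriorDirectSum.toProd K W₁ W₂).toLinearMap ∘ₗ (GradedTensorProduct.of K (extGrading K W₁) (extGrading K W₂)).toLinearMap) at key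
  rw [map_smul, toProd_of_tmul, mul_pow_eq_mul_pow, mul_pow_eq_mul_pow, LinearMap.mul_apply', LinearMap.mul_apply',
    apply_pow_of_semiconj (toProd_of_rTensor_add_lTensor_mul ω₁ hω₂), toProd_of_tmul, mul_pow_eq_mul_pow, LinearMap.mul_apply'] at key
  exact key

/-- **`*_L (p ∧ q) = C(a+b, a) · (ω₁ᵃ ∧ p) ∧ (ω₂ᵇ ∧ q) = C(a+b, a) · *_L p ∧ *_L q`** (`*_L` sends the bottom `p ∧ q` of the product string to
its top). [cite: Andre1996Motifs, §1.3 Lemme 1.3.1 (p. 13)] [cite: Andre1996Motifs, §1.1 (p. 10, definition of *_L)] -/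
theorem IsSymplectic.lefschetzStar_inl_add_inr_apply_of_mem_primitive (hω₁ : IsSymplectic ω₁ g₁) (hω₂ : IsSymplectic ω₂ g₂)
    {k₁ k₂ : ℕ} (hk₁ : k₁ ≤ g₁) (hk₂ : k₂ ≤ g₂) {p : ExteriorAlgebra K W₁} {q : ExteriorAlgebra K W₂} (hp : p ∈ primitive ω₁ g₁ k₁)
    (hq : q ∈ primitive ω₂ g₂ k₂) :
    lefschetzStar (ExteriorAlgebra.map (LinearMap.inl K W₁ W₂) ω₁ + ExteriorAlgebra.map (LinearMap.inr K W₁ W₂) ω₂) (g₁ + g₂)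
        (ExteriorAlgebra.map (LinearMap.inl K W₁ W₂) p * ExteriorAlgebra.map (LinearMap.inr K W₁ W₂) q) =
      ((((g₁ - k₁) + (g₂ - k₂)).choose (g₁ - k₁) : ℕ) : K) •
        (ExteriorAlgebra.map (LinearMap.inl K W₁ W₂) (lefschetzStar ω₁ g₁ p) * ExteriorAlgebra.map (LinearMap.inr K W₁ W₂) (lefschetzStar ω₂ g₂ q)) := by
  have hΩ := hω₁.inl_add_inr hω₂
  rw [hω₁.lefschetzStar_apply_of_mem hk₁ (primitive_le _ _ _ hp), hω₂.lefschetzStar_apply_of_mem hk₂ (primitive_le _ _ _ hq),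
    hΩ.lefschetzStar_apply_of_mem (add_le_add hk₁ hk₂) (map_inl_mul_map_inr_mem_exteriorPower (primitive_le _ _ _ hp)
      (primitive_le _ _ _ hq)), show g₁ + g₂ - (k₁ + k₂) = (g₁ - k₁) + (g₂ - k₂) by omega,
    inl_add_inr_pow_mul_of_mem_primitive ω₁ hω₂.mem hk₁ hk₂ hp hq]

/-- **LEMME 1.3.1, LEFSCHETZ CLAUSE, on `⋀(W₁ ⊕ W₂)`: `*_L ((ω₁ᵃ ∧ p) ∧ (ω₂ᵇ ∧ q)) = C(a+b, a)⁻¹ · p ∧ q = C(a+b, a)⁻¹ · *_L(ω₁ᵃ ∧ p) ∧ *_L(ω₂ᵇ ∧ q)`**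
(`a = g₁ − k₁`, `b = g₂ − k₂`): on the top `L^{d−i}Pⁱ(X) ⊗ L^{d'−j}Pʲ(Y)` of a product string the Lefschetz involution of the product and
`*_{L,X} ⊗ *_{L,Y}` coincide up to `c⁻¹` (row g31-#2 `lefschetzInvolution_tensor_apply_top'`, transported along `Φ`).
[cite: Andre1996Motifs, §1.3 Lemme 1.3.1 (p. 13)] -/
theorem IsSymplectic.lefschetzStar_inl_add_inr_apply_top (hω₁ : IsSymplectic ω₁ g₁) (hω₂ : IsSymplectic ω₂ g₂) {k₁ k₂ : ℕ}
    (hk₁ : k₁ ≤ g₁) (hk₂ : k₂ ≤ g₂) {p : ExteriorAlgebra K W₁} {q : ExteriorAlgebra K W₂} (hp : p ∈ primitive ω₁ g₁ k₁)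
    (hq : q ∈ primitive ω₂ g₂ k₂) :
    lefschetzStar (ExteriorAlgebra.map (LinearMap.inl K W₁ W₂) ω₁ + ExteriorAlgebra.map (LinearMap.inr K W₁ W₂) ω₂) (g₁ + g₂)
        (ExteriorAlgebra.map (LinearMap.inl K W₁ W₂) (ω₁ ^ (g₁ - k₁) * p) * ExteriorAlgebra.map (LinearMap.inr K W₁ W₂) (ω₂ ^ (g₂ - k₂) * q)) =
      ((((g₁ - k₁) + (g₂ - k₂)).choose (g₁ - k₁) : ℕ) : K)⁻¹ •
        (ExteriorAlgebra.map (LinearMap.inl K W₁ W₂) p * ExteriorAlgebra.map (LinearMap.inr K W₁ W₂) q) := by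
  haveI := hω₁.finiteDimensional_exteriorAlgebra
  haveI := hω₂.finiteDimensional_exteriorAlgebra
  have hΩ := hω₁.inl_add_inr hω₂
  haveI := hΩ.finiteDimensional_exteriorAlgebra
  have hp' := hp
  have hq' := hq
  rw [primitive_eq_primitiveSpace _ _ hk₁] at hp'
  rw [primitive_eq_primitiveSpace _ _ hk₂] at hq'
  have key := (hω₁.hasLefschetzProperty_mul.tensor (isZGrading_shiftedDegree K (fun i : ℕ ↦ ⋀[K]^i W₁) g₁)
    hω₂.hasLefschetzProperty_mul (isZGrading_shiftedDegree K (fun i : ℕ ↦ ⋀[K]^i W₂) g₂)).map_lefschetzInvolution_of_semiconj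
    (isZGrading_rTensor_add_lTensor (isZGrading_shiftedDegree K (fun i : ℕ ↦ ⋀[K]^i W₁) g₁)
      (isZGrading_shiftedDegree K (fun i : ℕ ↦ ⋀[K]^i W₂) g₂))
    hΩ.hasLefschetzProperty_mul (isZGrading_shiftedDegree K (fun i : ℕ ↦ ⋀[K]^i (W₁ × W₂)) (g₁ + g₂))
    (toProd_of_rTensor_add_lTensor_shiftedDegree g₁ g₂) (toProd_of_rTensor_add_lTensor_mul ω₁ hω₂.mem)
    (((LinearMap.mul K (ExteriorAlgebra K W₁) ω₁) ^ (g₁ - k₁)) p ⊗ₜ[K] ((LinearMap.mul K (ExteriorAlgebra K W₂) ω₂) ^ (g₂ - k₂)) q)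
  rw [hω₁.hasLefschetzProperty_mul.lefschetzInvolution_tensor_apply_top' (isZGrading_shiftedDegree K _ g₁) hω₂.hasLefschetzProperty_mul
      (isZGrading_shiftedDegree K _ g₂) hp' hq', map_smul, toProd_of_tmul, toProd_of_tmul, mul_pow_eq_mul_pow, mul_pow_eq_mul_pow,
    LinearMap.mul_apply', LinearMap.mul_apply', ← hΩ.lefschetzStar_eq] at key
  exact key.symm

end Symplectic

end ExteriorLefschetz

end Literature.AlgebraicGeometry.Motives
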